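import Literature.Barriers.CriticalPhenomena.PlaquetteWalkHoleRootPrefixLoop
import Literature.Probability.RandomPlanarGeometry.YangBaxterSAWHexDictionarySignedWinding
import HarnessLib

/-!
# Barrier catalogue (SAWScalingLimit): CLOSED kill-forced zeros of the Yang–Baxter vertex functional — the free
witnesses certified by the kernel

Leaf of `PlaquetteWalkHoleRootPrefixLoop` (with it, both universal honeycomb kills of every row of the venture
lane's corner-kill table are theorem schemas) and of `YangBaxterSAWHexDictionarySignedWinding` (woundness
`WE ≠ excursionWinding` is `AJ ≠ 0` at the root, `ΩG.WE_ne_excursionWinding_iff_AJ_root_ne_zero`). The lane's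
kill-forced zero theorems (`PlaquetteWalkHoleRootKillForcedZeros` §4/§4′, `PlaquetteWalkHoleRootStructuralKill` §8/§9,
`PlaquetteWalkHoleRootPrefixLoop` §5) conclude `∃ θ ∈ (π/3, 2π/3), VF(θ) = 0` at the far cell of a hole root from the
kill geometry AND two existential FREE WITNESSES — one wound under-walk that is `w₂`-free (resp. `w₁`-free) off the
far cell and one wound over-walk that is `w₁`-free (resp. `w₂`-free) — which the lane has so far supplied by
enumeration outside the tree. This file supplies them INSIDE the tree for two named domains, so that the
corresponding zeros become CLOSED THEOREMS (no hypothesis):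

* §1 certificates for explicit walks: Boolean checks `arcMemCheck` / `noncrossCheck` with `arc_mem_of_check` /
  `noncross_of_check` (the two `YBWalk` fields that quantify over all faces), the Boolean ray predicate `eastRayB` with
  `eastRayB_iff`, ★ `ΩG.rayCountAt_holeFaceW_E_eq_card` (the parity law's ray count behind the root as a decidable
  count of excursion mid-edges `nth (F + j + 1)` on the bottom line east of the hole) and ★ `ΩG.WE_ne_excursionWinding_of_odd_card`
  — **a COMBINATORIAL woundness certificate**: an odd count makes the walk wound at every angle (parity law
  `ΩG.AJ_root_ne_zero_iff_odd_rayCountAt` + `ΩG.WE_ne_excursionWinding_iff_AJ_root_ne_zero`; no real arithmetic on the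
  winding sum is needed); `ΩG.firstSideG_eq_of_nth`. Everything else about an explicit walk — the `YBWalk` fields,
  `firstHitG`, the class-`B2a` criterion `ΩG.isB2a_of_forall_fc_ne`, `W2FreeOff` / `W1FreeOff`, the count — is decided by
  the kernel (`decide` on the lattice data; no `native_decide`).
* §2–§3 ★★★★ `vertexFunctional_printed_eastKillDom_exists_eq_zero` — on the lane's asymmetric EASTERN kill domain
  `eastKillDom = 6×5 ∖ {(3,2),(5,0),(5,4),(0,0)}` rooted at the `W` side of `(4,2)`, the vertex functional of the printed
  weights at the far cell `(2,2)` has an exact zero in `(π/3, 2π/3)`: `vertexFunctional_printed_farCellW_exists_eq_zero_Ioo_of_east_kills`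
  with the geometry read off the face list and the witnesses `underWitness` (18 arcs: wound — one excursion mid-edge
  on the eastern ray —, under, `w₂`-free) and `overWitness` (its row mirror: wound, over, `w₁`-free). Lane data: the
  zero lies in `[0.37208π, 0.37225π]`.
* §4 ★★★★ `vertexFunctional_printed_deadEndDom_exists_eq_zero` — the same for the asymmetric dead-end WESTERN kill domain
  `deadEndDom = 6×5 ∖ {(3,2),(1,0),(1,4),(0,1)}` via the parent's `…_of_kills_deadEnd` (`PlaquetteWalkHoleRootStructuralKill`
  §9) and the witnesses `deadEndOver` / `deadEndUnder`. Lane data: the zero lies in `[0.50557π, 0.50570π]`, OFF the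
  mirror point `π/2` (the domain has no row symmetry, so the zero is not the mirror zero of
  `PlaquetteWalkHoleRootMirrorZeros`).

These are the first zeros of the catalogue for NAMED domains with a hole that are proved with no enumeration
hypothesis and no symmetry: exact zeros of a 26-face hole-rooted Yang–Baxter vertex functional — for simply connected
domains rooted on the outer boundary the functional vanishes identically (`YangBaxterSAWGeneralDomain`), for hole
roots it does not (`PlaquetteWalkHoleRootDefect`), and here it has an isolated zero forced by the honeycomb kills.
The witnesses were found by a shortest-first search in the seat folder (venture lane «pcv-sawmu», seat b-step0
gen 25, `work/witness/find_witness.py`); their certification is the kernel's. Not in print.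

References: A. Glazman, I. Manolescu, arXiv:1708.00395v3, §1 (Fig. 1, Fig. 2, the remark after eq. (1)), §2.1 and
Lemma 2.1 [GlazmanManolescu2019]; A. Glazman, Electron. Commun. Probab. 20 (2015) no. 86, Lemma 3.1, proof pp. 6–7
[Glazman2015WeightedSAW]; R. Courant, H. Robbins, *What is Mathematics?* (1941/1958), Ch. V Appendix §2 (the even–odd
rule) [CourantRobbins1958]; H. Duminil-Copin, S. Smirnov, Ann. of Math. 175 (2012), Lemma 1 [DuminilCopinSmirnov2012].
-/

noncomputable section

open Set Function Complex

namespace Literature.Probability.RandomPlanarGeometry.SAW.YangBaxter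

open Real
open Literature.Barriers.CriticalPhenomena.PlaquetteWalk (dom)

open private side_jOut from Literature.Probability.RandomPlanarGeometry.YangBaxterSAWExcursionJordan

/-! ## §1 Certificates for explicit walks -/

/-- Boolean check that every arc of a mid-edge list is drawn in a face of the listed domain.
[cite: GlazmanManolescu2019, §1 (definition of the model: each arc lies in a rhombus of the domain)] -/
def arcMemCheck (Dl : List Face) (l : List MidEdge) : Bool :=
  (arcsOf l).all fun p => match arcFace p with | some f => decide (f ∈ Dl) | none => false

/-- The Boolean check certifies the `arc_mem` field of a walk in `dom Dl`. [cite: GlazmanManolescu2019, §1 (definition of the model)] -/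
theorem arc_mem_of_check {Dl : List Face} {l : List MidEdge} (h : arcMemCheck Dl l = true) :
    ∀ p ∈ arcsOf l, ∃ f ∈ dom Dl, arcFace p = some f := by
  intro p hp
  have h' := List.all_eq_true.1 h p hp
  cases hfp : arcFace p with
  | none => simp [hfp] at h'
  | some f =>
    simp only [hfp, decide_eq_true_eq] at h'
    exact ⟨f, h', rfl⟩

/-- Boolean check that no rhombus carries both straight arcs of a mid-edge list: for every horizontal straight arc
`{W, E}` of a face, neither orientation of the vertical straight arc `{S, N}` of that face occurs.
[cite: GlazmanManolescu2019, §1, Fig. 1 (the curve is simple: no rhombus contains the two crossing arcs)] -/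
def noncrossCheck (l : List MidEdge) : Bool :=
  (arcsOf l).all fun p =>
    match p with
    | (.vert k j, .vert k' j') =>
        if k' = k + 1 ∧ j' = j then
          !(decide ((MidEdge.slant k j, MidEdge.slant k (j + 1)) ∈ arcsOf l)) &&
            !(decide ((MidEdge.slant k (j + 1), MidEdge.slant k j) ∈ arcsOf l))
        else if k = k' + 1 ∧ j = j' then
          !(decide ((MidEdge.slant k' j', MidEdge.slant k' (j' + 1)) ∈ arcsOf l)) &&
            !(decide ((MidEdge.slant k' (j' + 1), MidEdge.slant k' j') ∈ arcsOf l))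
        else true
    | _ => true

/-- The Boolean check certifies the `noncross` field of a walk. [cite: GlazmanManolescu2019, §1, Fig. 1 (the curve is simple)] -/
theorem noncross_of_check {l : List MidEdge} (h : noncrossCheck l = true) :
    ∀ f : Face, ((f.side .W, f.side .E) ∈ arcsOf l ∨ (f.side .E, f.side .W) ∈ arcsOf l) →
      ¬((f.side .S, f.side .N) ∈ arcsOf l ∨ (f.side .N, f.side .S) ∈ arcsOf l) := by
  intro f hWE hSN
  obtain ⟨k, j⟩ := f
  simp only [Face.side] at hWE hSN
  rcases hWE with h1 | h1
  · have h' := List.all_eq_true.1 h _ h1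
    simp only [and_self, ↓reduceIte, Bool.and_eq_true, Bool.not_eq_eq_eq_not, Bool.not_true,
      decide_eq_false_iff_not] at h'
    exact absurd hSN (not_or.2 h')
  · have h' := List.all_eq_true.1 h _ h1
    dsimp only at h'
    rw [if_neg (by omega), if_pos (by omega)] at h'
    simp only [Bool.and_eq_true, Bool.not_eq_eq_eq_not, Bool.not_true, decide_eq_false_iff_not] at h'
    exact absurd hSN (not_or.2 h')

/-- Boolean form of «the mid-edge lies on the eastern ray of the hole»: a bottom side on the root row at a column
`≥ w.1`. [cite: CourantRobbins1958, Ch. V Appendix §2 (the even–odd rule: the ray)] -/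
def eastRayB (w : Face) : MidEdge → Bool
  | .slant k j => decide (j = w.2 ∧ w.1 ≤ k)
  | .vert _ _ => false

/-- The Boolean form is the ray-membership predicate of the parity law with the presentation `(holeFaceW w, E)` of
the root edge. [cite: CourantRobbins1958, Ch. V Appendix §2 (the even–odd rule: the ray)] -/
theorem eastRayB_iff (w : Face) (e : MidEdge) : (∃ m : ℕ, e = rayMid (holeFaceW w) .E m) ↔ eastRayB w e = true := by
  constructor
  · rintro ⟨m, rfl⟩
    rw [rayMid_holeFaceW_E_eq]
    have hm : w.1 ≤ w.1 + (m : ℤ) := by omega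
    simp [eastRayB, hm]
  · intro h
    cases e with
    | vert k j => simp [eastRayB] at h
    | slant k j =>
      simp only [eastRayB, decide_eq_true_eq] at h
      refine ⟨(k - w.1).toNat, ?_⟩
      rw [rayMid_holeFaceW_E_eq, h.1]
      congr 1
      omega

namespace ΩG

variable {D : Set Face} {w : Face}

/-- **The ray count behind the root, in decidable form**: the number of excursion mid-edges `nth (F + j + 1)`,
`j < Mv`, on the eastern ray. [cite: CourantRobbins1958, Ch. V Appendix §2 (The Jordan Curve Theorem for Polygons: the even–odd rule)] -/
theorem rayCountAt_holeFaceW_E_eq_card (ω : ΩG D (w.side .W) (farW w)) (hr : RootedFace D (w.side .W) (farW w))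
    (h : ω.IsB2a) :
    ω.rayCountAt hr h (holeFaceW w) .E =
      ((Finset.range ω.Mv).filter fun j => eastRayB w (ω.2.nth (ω.2.firstHitG + j + 1)) = true).card := by
  classical
  unfold ΩG.rayCountAt
  congr 1
  refine Finset.filter_congr fun j hj => ?_
  rw [Finset.mem_range] at hj
  rw [← eastRayB_iff, side_jOut (hr := hr) h hj]

/-- ★ **A COMBINATORIAL WOUNDNESS CERTIFICATE**: if an odd number of excursion mid-edges lie on the eastern ray of
the hole, the walk is WOUND at every angle (`WE ≠ excursionWinding`): the parity law gives `AJ ≠ 0` at the root,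
and woundness is `AJ ≠ 0` (`ΩG.WE_ne_excursionWinding_iff_AJ_root_ne_zero`).
[cite: CourantRobbins1958, Ch. V Appendix §2 (the even–odd rule)] [cite: GlazmanManolescu2019, Lemma 2.1]
[cite: Glazman2015WeightedSAW, Lemma 3.1 (proof, pp. 6–7)] -/
theorem WE_ne_excursionWinding_of_odd_card (ω : ΩG D (w.side .W) (farW w)) (hr : RootedFace D (w.side .W) (farW w))
    (h : ω.IsB2a)
    (hodd : Odd ((Finset.range ω.Mv).filter fun j => eastRayB w (ω.2.nth (ω.2.firstHitG + j + 1)) = true).card)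
    (θ : ℝ) : ω.WE (fun _ => θ) ≠ excursionWinding θ ω.2.firstSideG (ω.z1 hr h) ω.1 := by
  rw [← rayCountAt_holeFaceW_E_eq_card ω hr h] at hodd
  exact (ω.WE_ne_excursionWinding_iff_AJ_root_ne_zero hr h θ).2
    ((ω.AJ_root_ne_zero_iff_odd_rayCountAt (hr := hr) h (holeFaceW_side_E w)).2 hodd)

/-- The first side read off the mid-edge at the first hit. [cite: Glazman2015WeightedSAW, Lemma 3.1 (proof, pp. 6–7: the first crossing of ∂r)] -/
theorem firstSideG_eq_of_nth {a : MidEdge} {r : Face} (ω : ΩG D a r) {s : Side}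
    (e : ω.2.nth ω.2.firstHitG = r.side s) : ω.2.firstSideG = s :=
  Face.side_injective r (ω.2.nth_firstHitG.symm.trans e)

end ΩG

end Literature.Probability.RandomPlanarGeometry.SAW.YangBaxter

/-! ## §2 The lane's asymmetric eastern kill domain and its two free witnesses -/

namespace Literature.Barriers.CriticalPhenomena.PlaquetteWalk

open Literature.Probability.RandomPlanarGeometry.SAW.YangBaxter
open Real Complex

/-- The venture lane's asymmetric eastern kill domain `6×5 ∖ {(3,2),(5,0),(5,4),(0,0)}` (26 faces): root plaquette
`w = (4,2)` rooted at its `W` side, hole `(3,2)`, far cell `(2,2)`, eastern kill cells `K_S1 = (5,0)`,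
`K_N2 = (5,4)`, and `(0,0)` removed to break the row symmetry. [cite: GlazmanManolescu2019, §2.1 (finite domains of faces)] -/
def eastKillDom : List Face :=
  [(0,1),(0,2),(0,3),(0,4),(1,0),(1,1),(1,2),(1,3),(1,4),(2,0),(2,1),(2,2),(2,3),(2,4),
   (3,0),(3,1),(3,3),(3,4),(4,0),(4,1),(4,2),(4,3),(4,4),(5,1),(5,2),(5,3)]

/-- The root plaquette of the instance. [cite: GlazmanManolescu2019, §2.1 (finite domains of faces)] -/
def w42 : Face := (4, 2)

/-- The mid-edges of the UNDER witness: `W` side of `(4,2)` → down through `(4,2).S` → west along row `1` → into the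
far cell `(2,2)` from below → out through its `W` side → around the bottom row → up column `5` (crossing the bottom side
of `(5,2)`, the top side of the eastern pocket) → west along row `3` → back into the far cell from above.
[cite: GlazmanManolescu2019, §1 (definition of the model)] -/
def underMids : List MidEdge :=
  [.vert 4 2, .slant 4 2, .vert 4 1, .vert 3 1, .slant 2 2, .vert 2 2, .slant 1 2, .slant 1 1, .vert 2 0, .vert 3 0,
    .vert 4 0, .slant 4 1, .vert 5 1, .slant 5 2, .slant 5 3, .vert 5 3, .vert 4 3, .vert 3 3, .slant 2 3]

/-- The mid-edges of the OVER witness: the row mirror of the under witness (it avoids `(5,4)` and `(5,0)` and does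
not need `(0,0)`). [cite: GlazmanManolescu2019, §1 (definition of the model)] -/
def overMids : List MidEdge :=
  [.vert 4 2, .slant 4 3, .vert 4 3, .vert 3 3, .slant 2 3, .vert 2 2, .slant 1 3, .slant 1 4, .vert 2 4, .vert 3 4,
    .vert 4 4, .slant 4 4, .vert 5 3, .slant 5 3, .slant 5 2, .vert 5 1, .vert 4 1, .vert 3 1, .slant 2 2]

/-- **The under witness as a Yang–Baxter walk** of `dom eastKillDom` from the root to the far cell's `N` side (all
fields by computation). [cite: GlazmanManolescu2019, §1 (definition of the model), Fig. 1] -/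
def underWitness : YBWalk (dom eastKillDom) (w42.side .W) ((farW w42).side .N) where
  mids := underMids
  head_eq := by decide
  getLast_eq := by decide
  nodup := by decide
  arc_mem := arc_mem_of_check (by decide)
  isChain := by decide
  noncross := noncross_of_check (by decide)

/-- **The over witness as a Yang–Baxter walk** of `dom eastKillDom` from the root to the far cell's `S` side.
[cite: GlazmanManolescu2019, §1 (definition of the model), Fig. 1] -/
def overWitness : YBWalk (dom eastKillDom) (w42.side .W) ((farW w42).side .S) where
  mids := overMids
  head_eq := by decide
  getLast_eq := by decide
  nodup := by decide
  arc_mem := arc_mem_of_check (by decide)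
  isChain := by decide
  noncross := noncross_of_check (by decide)

/-- The under witness as a labelled walk at the far cell (it ends at the `N` side). [cite: Glazman2015WeightedSAW, Lemma 3.1 (proof, pp. 6–7: the classes of walks through a rhombus)] -/
def ωU : ΩG (dom eastKillDom) (w42.side .W) (farW w42) := ⟨.N, underWitness⟩

/-- The over witness as a labelled walk at the far cell (it ends at the `S` side). [cite: Glazman2015WeightedSAW, Lemma 3.1 (proof, pp. 6–7: the classes of walks through a rhombus)] -/
def ωO : ΩG (dom eastKillDom) (w42.side .W) (farW w42) := ⟨.S, overWitness⟩

/-- The far cell is rooted: it lies in the domain and the root is not interior (the hole is absent).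
[cite: GlazmanManolescu2019, §2.1 (walks start on the boundary of the domain)] -/
theorem rootedFace_eastKillDom : RootedFace (dom eastKillDom) (w42.side .W) (farW w42) :=
  ⟨show farW w42 ∈ eastKillDom by decide,
    show ¬((w42.side .W).faces.1 ∈ eastKillDom ∧ (w42.side .W).faces.2 ∈ eastKillDom) by decide⟩

/-- The bottom line of the root row is uncrossable east of column `5`: the box ends there. [cite: GlazmanManolescu2019, §2.1 (finite domains of faces)] -/
theorem eastKillDom_rowS (x : ℤ) (hx : w42.1 + 2 ≤ x) : (x, w42.2) ∉ dom eastKillDom ∨ (x, w42.2 - 1) ∉ dom eastKillDom := by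
  left
  show (x, w42.2) ∉ eastKillDom
  simp only [w42] at hx ⊢
  simp only [eastKillDom, List.mem_cons, Prod.mk.injEq, List.not_mem_nil, or_false, not_or, not_and]
  omega

/-- The top line of the root row is uncrossable east of column `5`. [cite: GlazmanManolescu2019, §2.1 (finite domains of faces)] -/
theorem eastKillDom_rowN (x : ℤ) (hx : w42.1 + 2 ≤ x) : (x, w42.2) ∉ dom eastKillDom ∨ (x, w42.2 + 1) ∉ dom eastKillDom := by
  left
  show (x, w42.2) ∉ eastKillDom
  simp only [w42] at hx ⊢
  simp only [eastKillDom, List.mem_cons, Prod.mk.injEq, List.not_mem_nil, or_false, not_or, not_and]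
  omega

/-! ### The under witness: first hit, class, first side, freeness, woundness -/

/-- The under witness first hits the far cell at index `4`. [cite: Glazman2015WeightedSAW, Lemma 3.1 (proof, pp. 6–7: the first crossing of ∂r)] -/
theorem ωU_firstHitG : ωU.2.firstHitG = 4 := by decide

/-- The under witness has `18` arcs. [folklore] -/
private theorem ωU_length : ωU.2.arcs.length = 18 := by decide

/-- The under witness is of class `B2a`: after its arc in the far cell it draws no further arc there.
[cite: Glazman2015WeightedSAW, Lemma 3.1 (proof, pp. 6–7: the classes of walks through a rhombus)] -/
theorem ωU_isB2a : ωU.IsB2a := by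
  refine ΩG.isB2a_of_forall_fc_ne (by rw [ωU_firstHitG, ωU_length]; omega) fun j hj1 hj2 => ?_
  rw [ωU_firstHitG] at hj1
  rw [ωU_length] at hj2
  have key : ∀ j < 18, 4 < j → ωU.2.fc j ≠ farW w42 := by decide
  exact key j hj2 hj1

/-- The under witness is an UNDER-walk (first side `S`). [cite: Glazman2015WeightedSAW, Lemma 3.1 (proof, pp. 6–7)] -/
theorem ωU_firstSideG : ωU.2.firstSideG = .S :=
  ΩG.firstSideG_eq_of_nth ωU (by rw [ωU_firstHitG]; decide)

/-- The under witness is `w₂`-FREE off the far cell (no rhombus other than the far cell carries two co-corner arcs).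
[cite: GlazmanManolescu2019, §1 (the paragraph of Fig. 2: «if θ = π/3, then w₂ = 0»)] -/
theorem ωU_W2FreeOff : ωU.2.W2FreeOff (farW w42) := by
  unfold YBWalk.W2FreeOff; decide

/-- The under witness is WOUND at every angle: exactly one excursion mid-edge (the bottom side of `(5,2)`, the top of
the eastern pocket) lies on the eastern ray of the hole. [cite: CourantRobbins1958, Ch. V Appendix §2 (the even–odd rule)]
[cite: GlazmanManolescu2019, Lemma 2.1] -/
theorem ωU_wound (θ : ℝ) :
    ωU.WE (fun _ => θ) ≠ excursionWinding θ ωU.2.firstSideG (ωU.z1 rootedFace_eastKillDom ωU_isB2a) ωU.1 := by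
  refine ΩG.WE_ne_excursionWinding_of_odd_card ωU rootedFace_eastKillDom ωU_isB2a ?_ θ
  have hM : ωU.Mv = 14 := by unfold ΩG.Mv; rw [ωU_firstHitG, ωU_length]
  rw [hM, ωU_firstHitG]
  decide

/-! ### The over witness -/

/-- The over witness first hits the far cell at index `4`. [cite: Glazman2015WeightedSAW, Lemma 3.1 (proof, pp. 6–7: the first crossing of ∂r)] -/
theorem ωO_firstHitG : ωO.2.firstHitG = 4 := by decide

/-- The over witness has `18` arcs. [folklore] -/
private theorem ωO_length : ωO.2.arcs.length = 18 := by decide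

/-- The over witness is of class `B2a`. [cite: Glazman2015WeightedSAW, Lemma 3.1 (proof, pp. 6–7: the classes of walks through a rhombus)] -/
theorem ωO_isB2a : ωO.IsB2a := by
  refine ΩG.isB2a_of_forall_fc_ne (by rw [ωO_firstHitG, ωO_length]; omega) fun j hj1 hj2 => ?_
  rw [ωO_firstHitG] at hj1
  rw [ωO_length] at hj2
  have key : ∀ j < 18, 4 < j → ωO.2.fc j ≠ farW w42 := by decide
  exact key j hj2 hj1

/-- The over witness is an OVER-walk (first side `N`). [cite: Glazman2015WeightedSAW, Lemma 3.1 (proof, pp. 6–7)] -/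
theorem ωO_firstSideG : ωO.2.firstSideG = .N :=
  ΩG.firstSideG_eq_of_nth ωO (by rw [ωO_firstHitG]; decide)

/-- The over witness is `w₁`-FREE off the far cell (no rhombus other than the far cell carries two corner arcs).
[cite: GlazmanManolescu2019, §1, remark after eq. (1) («w₁ = 0 at θ = 2π/3»)] -/
theorem ωO_W1FreeOff : ωO.2.W1FreeOff (farW w42) := by
  unfold YBWalk.W1FreeOff; decide

/-- The over witness is WOUND at every angle (one excursion mid-edge on the eastern ray: the bottom side of `(5,2)`).
[cite: CourantRobbins1958, Ch. V Appendix §2 (the even–odd rule)] [cite: GlazmanManolescu2019, Lemma 2.1] -/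
theorem ωO_wound (θ : ℝ) :
    ωO.WE (fun _ => θ) ≠ excursionWinding θ ωO.2.firstSideG (ωO.z1 rootedFace_eastKillDom ωO_isB2a) ωO.1 := by
  refine ΩG.WE_ne_excursionWinding_of_odd_card ωO rootedFace_eastKillDom ωO_isB2a ?_ θ
  have hM : ωO.Mv = 14 := by unfold ΩG.Mv; rw [ωO_firstHitG, ωO_length]
  rw [hM, ωO_firstHitG]
  decide

/-! ## §3 The closed zero -/

/-- ★★★★ **THE FIRST CLOSED KILL-FORCED ZERO.** On the 26-face domain `6×5 ∖ {(3,2),(5,0),(5,4),(0,0)}` rooted at the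
`W` side of `(4,2)`, the Yang–Baxter vertex functional of the printed weights at the far cell `(2,2)` has an EXACT ZERO
at some angle `θ ∈ (π/3, 2π/3)` — no hypothesis left: the eastern kill geometry is read off the face list, the two
universal kills are the structural theorems of `PlaquetteWalkHoleRootPrefixLoop`, and the two free witnesses are the
explicit walks `underWitness` (wound, `w₂`-free) and `overWitness` (wound, `w₁`-free) certified above. (Lane data: the
zero lies in `[0.37208π, 0.37225π]`; the printed sources have no zero here to compare — for simply connected domains
rooted on the outer boundary the functional vanishes identically.) [cite: GlazmanManolescu2019, Lemma 2.1 (statement, "in the form given in [Gl]")]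
[cite: GlazmanManolescu2019, §1 (the paragraph of Fig. 2 and the remark after eq. (1))]
[cite: Glazman2015WeightedSAW, Lemma 3.1 (proof, pp. 6–7)] [cite: DuminilCopinSmirnov2012, proof of Lemma 1]
[cite: CourantRobbins1958, Ch. V Appendix §2 (The Jordan Curve Theorem for Polygons: the even–odd rule)] -/
theorem vertexFunctional_printed_eastKillDom_exists_eq_zero :
    ∃ θ ∈ Set.Ioo (π / 3) (2 * π / 3),
      vertexFunctional (printedWeights θ) tFiveEighths (ybCoeff θ) eastKillDom (w42.side .W) (farW w42) = 0 := by
  exact vertexFunctional_printed_farCellW_exists_eq_zero_Ioo_of_east_kills eastKillDom w42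
    (show farW w42 ∈ eastKillDom by decide) (show holeFaceW w42 ∉ eastKillDom by decide) rootedFace_eastKillDom
    (show killNE w42 ∉ eastKillDom by decide) (show pocketNEE w42 ∉ eastKillDom by decide) eastKillDom_rowN
    (show killSE w42 ∉ eastKillDom by decide) (show pocketSEE w42 ∉ eastKillDom by decide) eastKillDom_rowS
    ⟨ωU, ωU_isB2a, ωU_firstSideG, ωU_wound _, ωU_W2FreeOff⟩ ⟨ωO, ωO_isB2a, ωO_firstSideG, ωO_wound _, ωO_W1FreeOff⟩

/-! ## §4 A second closed zero: the asymmetric dead-end WEST-kill domain -/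

/-- The venture lane's asymmetric dead-end west-kill domain `6×5 ∖ {(3,2),(1,0),(1,4),(0,1)}` (26 faces): root
plaquette `(4,2)`, hole `(3,2)`, far cell `(2,2)`, western kill cells `K_S2 = (1,0)` and `K_N1 = (1,4)` (the dead-end
column geometry of `PlaquetteWalkHoleRootStructuralKill` §9: the pocket column `0` is alive), `(0,1)` removed to break
the row symmetry. [cite: GlazmanManolescu2019, §2.1 (finite domains of faces)] -/
def deadEndDom : List Face :=
  [(0,0),(0,2),(0,3),(0,4),(1,1),(1,2),(1,3),(2,0),(2,1),(2,2),(2,3),(2,4),(3,0),(3,1),(3,3),(3,4),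
   (4,0),(4,1),(4,2),(4,3),(4,4),(5,0),(5,1),(5,2),(5,3),(5,4)]

/-- The mid-edges of the dead-end domain's OVER witness (wound, `w₂`-free). [cite: GlazmanManolescu2019, §1 (definition of the model)] -/
def deadEndOverMids : List MidEdge :=
  [.vert 4 2, .slant 4 3, .vert 4 3, .vert 3 3, .slant 2 3, .vert 2 2, .slant 1 3, .vert 2 3, .slant 2 4, .vert 3 4,
    .vert 4 4, .vert 5 4, .slant 5 4, .slant 5 3, .vert 5 2, .slant 4 2, .vert 4 1, .vert 3 1, .slant 2 2]

/-- The mid-edges of the dead-end domain's UNDER witness (wound, `w₁`-free). [cite: GlazmanManolescu2019, §1 (definition of the model)] -/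
def deadEndUnderMids : List MidEdge :=
  [.vert 4 2, .slant 4 2, .vert 4 1, .vert 3 1, .slant 2 2, .vert 2 2, .slant 1 2, .vert 2 1, .slant 2 1, .vert 3 0,
    .vert 4 0, .vert 5 0, .slant 5 1, .slant 5 2, .vert 5 2, .slant 4 3, .vert 4 3, .vert 3 3, .slant 2 3]

/-- The dead-end OVER witness as a Yang–Baxter walk (to the far cell's `S` side). [cite: GlazmanManolescu2019, §1 (definition of the model), Fig. 1] -/
def deadEndOver : YBWalk (dom deadEndDom) (w42.side .W) ((farW w42).side .S) where
  mids := deadEndOverMids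
  head_eq := by decide
  getLast_eq := by decide
  nodup := by decide
  arc_mem := arc_mem_of_check (by decide)
  isChain := by decide
  noncross := noncross_of_check (by decide)

/-- The dead-end UNDER witness as a Yang–Baxter walk (to the far cell's `N` side). [cite: GlazmanManolescu2019, §1 (definition of the model), Fig. 1] -/
def deadEndUnder : YBWalk (dom deadEndDom) (w42.side .W) ((farW w42).side .N) where
  mids := deadEndUnderMids
  head_eq := by decide
  getLast_eq := by decide
  nodup := by decide
  arc_mem := arc_mem_of_check (by decide)
  isChain := by decide
  noncross := noncross_of_check (by decide)

/-- The dead-end over witness, labelled. [cite: Glazman2015WeightedSAW, Lemma 3.1 (proof, pp. 6–7: the classes of walks through a rhombus)] -/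
def ωDO : ΩG (dom deadEndDom) (w42.side .W) (farW w42) := ⟨.S, deadEndOver⟩

/-- The dead-end under witness, labelled. [cite: Glazman2015WeightedSAW, Lemma 3.1 (proof, pp. 6–7: the classes of walks through a rhombus)] -/
def ωDU : ΩG (dom deadEndDom) (w42.side .W) (farW w42) := ⟨.N, deadEndUnder⟩

/-- The far cell is rooted in the dead-end domain. [cite: GlazmanManolescu2019, §2.1 (walks start on the boundary of the domain)] -/
theorem rootedFace_deadEndDom : RootedFace (dom deadEndDom) (w42.side .W) (farW w42) :=
  ⟨show farW w42 ∈ deadEndDom by decide,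
    show ¬((w42.side .W).faces.1 ∈ deadEndDom ∧ (w42.side .W).faces.2 ∈ deadEndDom) by decide⟩

/-- First hit of the dead-end over witness. [cite: Glazman2015WeightedSAW, Lemma 3.1 (proof, pp. 6–7: the first crossing of ∂r)] -/
theorem ωDO_firstHitG : ωDO.2.firstHitG = 4 := by decide

/-- Length of the dead-end over witness. [folklore] -/
private theorem ωDO_length : ωDO.2.arcs.length = 18 := by decide

/-- The dead-end over witness is of class `B2a`. [cite: Glazman2015WeightedSAW, Lemma 3.1 (proof, pp. 6–7: the classes of walks through a rhombus)] -/
theorem ωDO_isB2a : ωDO.IsB2a := by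
  refine ΩG.isB2a_of_forall_fc_ne (by rw [ωDO_firstHitG, ωDO_length]; omega) fun j hj1 hj2 => ?_
  rw [ωDO_firstHitG] at hj1
  rw [ωDO_length] at hj2
  have key : ∀ j < 18, 4 < j → ωDO.2.fc j ≠ farW w42 := by decide
  exact key j hj2 hj1

/-- The dead-end over witness is an over-walk. [cite: Glazman2015WeightedSAW, Lemma 3.1 (proof, pp. 6–7)] -/
theorem ωDO_firstSideG : ωDO.2.firstSideG = .N :=
  ΩG.firstSideG_eq_of_nth ωDO (by rw [ωDO_firstHitG]; decide)

/-- The dead-end over witness is `w₂`-free off the far cell. [cite: GlazmanManolescu2019, §1 (the paragraph of Fig. 2: «if θ = π/3, then w₂ = 0»)] -/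
theorem ωDO_W2FreeOff : ωDO.2.W2FreeOff (farW w42) := by
  unfold YBWalk.W2FreeOff; decide

/-- The dead-end over witness is wound (one excursion mid-edge on the eastern ray: the bottom side of `w` itself).
[cite: CourantRobbins1958, Ch. V Appendix §2 (the even–odd rule)] [cite: GlazmanManolescu2019, Lemma 2.1] -/
theorem ωDO_wound (θ : ℝ) :
    ωDO.WE (fun _ => θ) ≠ excursionWinding θ ωDO.2.firstSideG (ωDO.z1 rootedFace_deadEndDom ωDO_isB2a) ωDO.1 := by
  refine ΩG.WE_ne_excursionWinding_of_odd_card ωDO rootedFace_deadEndDom ωDO_isB2a ?_ θ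
  have hM : ωDO.Mv = 14 := by unfold ΩG.Mv; rw [ωDO_firstHitG, ωDO_length]
  rw [hM, ωDO_firstHitG]
  decide

/-- First hit of the dead-end under witness. [cite: Glazman2015WeightedSAW, Lemma 3.1 (proof, pp. 6–7: the first crossing of ∂r)] -/
theorem ωDU_firstHitG : ωDU.2.firstHitG = 4 := by decide

/-- Length of the dead-end under witness. [folklore] -/
private theorem ωDU_length : ωDU.2.arcs.length = 18 := by decide

/-- The dead-end under witness is of class `B2a`. [cite: Glazman2015WeightedSAW, Lemma 3.1 (proof, pp. 6–7: the classes of walks through a rhombus)] -/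
theorem ωDU_isB2a : ωDU.IsB2a := by
  refine ΩG.isB2a_of_forall_fc_ne (by rw [ωDU_firstHitG, ωDU_length]; omega) fun j hj1 hj2 => ?_
  rw [ωDU_firstHitG] at hj1
  rw [ωDU_length] at hj2
  have key : ∀ j < 18, 4 < j → ωDU.2.fc j ≠ farW w42 := by decide
  exact key j hj2 hj1

/-- The dead-end under witness is an under-walk. [cite: Glazman2015WeightedSAW, Lemma 3.1 (proof, pp. 6–7)] -/
theorem ωDU_firstSideG : ωDU.2.firstSideG = .S :=
  ΩG.firstSideG_eq_of_nth ωDU (by rw [ωDU_firstHitG]; decide)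

/-- The dead-end under witness is `w₁`-free off the far cell. [cite: GlazmanManolescu2019, §1, remark after eq. (1) («w₁ = 0 at θ = 2π/3»)] -/
theorem ωDU_W1FreeOff : ωDU.2.W1FreeOff (farW w42) := by
  unfold YBWalk.W1FreeOff; decide

/-- The dead-end under witness is wound (one excursion mid-edge on the eastern ray: the bottom side of `(5,2)`).
[cite: CourantRobbins1958, Ch. V Appendix §2 (the even–odd rule)] [cite: GlazmanManolescu2019, Lemma 2.1] -/
theorem ωDU_wound (θ : ℝ) :
    ωDU.WE (fun _ => θ) ≠ excursionWinding θ ωDU.2.firstSideG (ωDU.z1 rootedFace_deadEndDom ωDU_isB2a) ωDU.1 := by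
  refine ΩG.WE_ne_excursionWinding_of_odd_card ωDU rootedFace_deadEndDom ωDU_isB2a ?_ θ
  have hM : ωDU.Mv = 14 := by unfold ΩG.Mv; rw [ωDU_firstHitG, ωDU_length]
  rw [hM, ωDU_firstHitG]
  decide

/-- ★★★★ **A SECOND CLOSED KILL-FORCED ZERO, off the mirror point.** On `6×5 ∖ {(3,2),(1,0),(1,4),(0,1)}` rooted at
the `W` side of `(4,2)`, the Yang–Baxter vertex functional of the printed weights at the far cell `(2,2)` vanishes at
some `θ ∈ (π/3, 2π/3)`: the dead-end column geometry is read off the face list, both universal kills are the parent's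
structural theorems (`…_of_kills_deadEnd`, `PlaquetteWalkHoleRootStructuralKill` §9), and the two free witnesses are
`deadEndOver` / `deadEndUnder` above. (Lane data: the zero lies in `[0.50557π, 0.50570π]`, OFF the mirror point
`π/2` — the domain has no row symmetry.) [cite: GlazmanManolescu2019, Lemma 2.1 (statement, "in the form given in [Gl]")]
[cite: GlazmanManolescu2019, §1 (the paragraph of Fig. 2 and the remark after eq. (1))]
[cite: Glazman2015WeightedSAW, Lemma 3.1 (proof, pp. 6–7)] [cite: DuminilCopinSmirnov2012, proof of Lemma 1]
[cite: CourantRobbins1958, Ch. V Appendix §2 (The Jordan Curve Theorem for Polygons: the even–odd rule)] -/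
theorem vertexFunctional_printed_deadEndDom_exists_eq_zero :
    ∃ θ ∈ Set.Ioo (π / 3) (2 * π / 3),
      vertexFunctional (printedWeights θ) tFiveEighths (ybCoeff θ) deadEndDom (w42.side .W) (farW w42) = 0 :=
  vertexFunctional_printed_farCellW_exists_eq_zero_Ioo_of_kills_deadEnd deadEndDom w42
    (show farW w42 ∈ deadEndDom by decide) (show holeFaceW w42 ∉ deadEndDom by decide) rootedFace_deadEndDom
    (show killSW w42 ∉ deadEndDom by decide) (show killNW w42 ∉ deadEndDom by decide)
    (fun x hx => Or.inl (show (x, w42.2) ∉ deadEndDom by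
      simp only [w42] at hx ⊢
      simp only [deadEndDom, List.mem_cons, Prod.mk.injEq, List.not_mem_nil, or_false, not_or, not_and]
      omega))
    (fun x hx => Or.inl (show (x, w42.2) ∉ deadEndDom by
      simp only [w42] at hx ⊢
      simp only [deadEndDom, List.mem_cons, Prod.mk.injEq, List.not_mem_nil, or_false, not_or, not_and]
      omega))
    (show ((w42.1 - 5, w42.2 - 1) : Face) ∉ deadEndDom by decide) (show ((w42.1 - 5, w42.2 - 2) : Face) ∉ deadEndDom by decide)
    (show ((w42.1 - 5, w42.2 + 1) : Face) ∉ deadEndDom by decide) (show ((w42.1 - 5, w42.2 + 2) : Face) ∉ deadEndDom by decide)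
    (show ((w42.1 - 4, w42.2 - 3) : Face) ∉ deadEndDom by decide) (show ((w42.1 - 4, w42.2 + 3) : Face) ∉ deadEndDom by decide)
    ⟨ωDO, ωDO_isB2a, ωDO_firstSideG, ωDO_wound _, ωDO_W2FreeOff⟩
    ⟨ωDU, ωDU_isB2a, ωDU_firstSideG, ωDU_wound _, ωDU_W1FreeOff⟩

end Literature.Barriers.CriticalPhenomena.PlaquetteWalk
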